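import Mathlib
import HarnessLib
import Summits.ValiantsHypothesis.ValiantsHypothesis.Theorems.LacunarySymmetroidMatrixDescartesProductPlusOneGlobalCells
import Summits.ValiantsHypothesis.ValiantsHypothesis.Theorems.LacunarySymmetroidMatrixDescartesProductPlusOneOneBumpLine
import Summits.ValiantsHypothesis.ValiantsHypothesis.Theorems.LacunarySymmetroidMatrixDescartesProductPlusOneBackgroundCell

/-!
# LINE (A) `product_plus_one` (crux `MatrixDescartes`, stmt-ValiantsHypothesis-18050, V1) — EB2-W in its OWN currency, part 2:
# pole companies with ONE bump row — one knee / one incoherent riser / one coherent row (`Z₊(W(∏ f_j)) ≤ 3·m + 2`, window-free, all rates)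

Part 1 (✓/⧗ `…GlobalCells`) supplies the window-assembly shell `card_posRoots_le_of_threePoint` (`Z₊(W) ≤ 3·Z₊(P) + 2` as soon as no three positive
roots of `W` sit in one closed root-free interval of `P`) and the window tools.  Here it is run on the `N = 1` classes of the mixed-rate ONE-BUMP cell
(✓ `oneBump_company_wronskian_no_three_zeros`, val-lit-p7 g17 #3b) and of the pure background cell (✓ `background_logWronskian_eval_neg`, W2), whose
menus are window-RELATIVE for trinomial rows (switched / unswitched) — the assembly picks the mode of the one trinomial row window by window:

* `oneKnee_poles_wronskian_card_le` — `K = 3`, `d 0 < d 1 < d 2`, every `m`: ONE knee binomial `j₀` on ANY pair and pole binomials on any pairs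
  elsewhere (all three rates at once) ⇒ `Z₊(W(∏_j f_j)) ≤ 3·m + 2` (`u = x₁`, `v = x₃` in the cell; `0 < f_j(x₁)f_j(x₃)` by the intermediate value theorem);
* `oneRiser_poles_wronskian_card_le` — ONE incoherent riser `(+,−,−)` (strict signs) + pole binomials ⇒ `≤ 3·m + 2`: left of the riser's root every
  row is a background row (the riser is an unswitched cloud row, `0 < f(v)`) and `W(∏ f_j)(x₁) < 0`; right of it the riser is the switched bump (`f(u) < 0`);
* `oneCoherent_poles_wronskian_card_le` — ONE coherent row `(+,+,−)` + pole binomials ⇒ `≤ 3·m + 2` (mirror: knee-phase bump `0 < f(v)` left of its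
  root, background `f(u) < 0` right of it);
* Euler twins `…_eulerNumerator_card_le`: `Z₊(eulerNumerator d a l₀) ≤ 5·m + 3` at EVERY coupling on the three classes
  (✓ `card_posRoots_eulerNumerator_le_wronskian_add_of_oneChange`) — the floor inequality of `OneChangeFloorK3` there.

HONEST FRAMING: helper; three `N = 1` SUB-CLASSES of EB2-W (one bump row against binomial poles of all rates) — the first def-`WronskianBudgetK3`-shaped
theorems with mixed rates, nothing more; several bumps per window (the located `2N` law, B-SHARP2/3) are NOT covered; `WronskianBudgetK3`,
`OneChangeFloorK3`, `stub_classRowK3`, `stub_eulerBoundK3`, `stub_polyLaw`, `MatrixDescartes` (18050), Conjecture B are NOT proved; `VP ≠ VNP` is NOT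
proved.  No definitions, no named facts, no sorry; Mathlib + ✓ lane modules only.
-/

set_option linter.dupNamespace false

namespace Summit.ValiantsHypothesis.ValiantsHypothesis.Theorems.LacunarySymmetroidMatrixDescartes

namespace ProductPlusOne

open Finset Set Polynomial
open scoped BigOperators Topology Polynomial

/-! ### The one-bump pole classes (`K = 3`) -/

section Classes

variable {m : ℕ} (d : Fin 3 → ℕ) (a : Fin m → Fin 3 → ℝ)

/-- Pole binomials on any pair are one-change rows. [folklore] -/
theorem poleBinomial_oneChange {b : Fin 3 → ℝ}
    (h : (b 2 = 0 ∧ b 0 * b 1 < 0) ∨ (b 0 = 0 ∧ b 1 * b 2 < 0) ∨ (b 1 = 0 ∧ b 0 * b 2 < 0)) :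
    ¬ (b 0 * b 1 < 0 ∧ b 1 * b 2 < 0) := by
  rcases h with h | h | h
  · exact not_dip_of_zero_letter (Or.inr (Or.inr h.1))
  · exact not_dip_of_zero_letter (Or.inl h.1)
  · exact not_dip_of_zero_letter (Or.inr (Or.inl h.1))

/-- The rows of the one-knee pole class are one-change rows. [folklore] -/
theorem oneKnee_poles_oneChange (j₀ : Fin m)
    (hknee : (a j₀ 2 = 0 ∧ 0 < a j₀ 0 * a j₀ 1) ∨ (a j₀ 0 = 0 ∧ 0 < a j₀ 1 * a j₀ 2) ∨ (a j₀ 1 = 0 ∧ 0 < a j₀ 0 * a j₀ 2))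
    (hpole : ∀ j, j ≠ j₀ → (a j 2 = 0 ∧ a j 0 * a j 1 < 0) ∨ (a j 0 = 0 ∧ a j 1 * a j 2 < 0) ∨ (a j 1 = 0 ∧ a j 0 * a j 2 < 0)) :
    ∀ j, ¬ (a j 0 * a j 1 < 0 ∧ a j 1 * a j 2 < 0) := by
  intro j
  by_cases hj : j = j₀
  · subst hj
    rcases hknee with h | h | h
    · exact not_dip_of_zero_letter (Or.inr (Or.inr h.1))
    · exact not_dip_of_zero_letter (Or.inl h.1)
    · exact not_dip_of_zero_letter (Or.inr (Or.inl h.1))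
  · exact poleBinomial_oneChange (hpole j hj)

/-- ★★ **EB2-W ON THE ONE-KNEE POLE CLASS** (`K = 3`, every `m`, window-free, all three rates): ONE knee binomial row `j₀` on any pair (`(+,+,0)`,
`(0,+,+)`, `(+,0,+)` up to sign) and pole binomials on any pairs elsewhere ⇒ `Z₊(W(∏_j f_j)) ≤ 3·m + 2` (on every root-free window the company is a
mixed-rate one-bump company, ✓ `oneBump_company_wronskian_no_three_zeros`). [this file's theorem] -/
theorem oneKnee_poles_wronskian_card_le (h01 : d 0 < d 1) (h12 : d 1 < d 2) (j₀ : Fin m)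
    (hknee : (a j₀ 2 = 0 ∧ 0 < a j₀ 0 * a j₀ 1) ∨ (a j₀ 0 = 0 ∧ 0 < a j₀ 1 * a j₀ 2) ∨ (a j₀ 1 = 0 ∧ 0 < a j₀ 0 * a j₀ 2))
    (hpole : ∀ j, j ≠ j₀ → (a j 2 = 0 ∧ a j 0 * a j 1 < 0) ∨ (a j 0 = 0 ∧ a j 1 * a j 2 < 0) ∨ (a j 1 = 0 ∧ a j 0 * a j 2 < 0)) :
    (((∏ j, ∑ l, C (a j l) * X ^ (d l) : ℝ[X]) * (X * derivative (X * derivative (∏ j, ∑ l, C (a j l) * X ^ (d l) : ℝ[X])))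
        - (X * derivative (∏ j, ∑ l, C (a j l) * X ^ (d l) : ℝ[X])) ^ 2).roots.toFinset.filter (fun t => 0 < t)).card ≤ 3 * m + 2 := by
  classical
  set P : ℝ[X] := ∏ j, ∑ l, C (a j l) * X ^ (d l) with hPdef
  by_cases hP : P = 0
  · rw [wronskian_card_eq_zero_of_prod_eq_zero d a hP]; exact Nat.zero_le _
  obtain ⟨e₁, he₁⟩ := Nat.exists_eq_add_of_lt h01
  obtain ⟨e₂, he₂⟩ := Nat.exists_eq_add_of_lt h12
  have hone := oneKnee_poles_oneChange a j₀ hknee hpole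
  have hZP : (P.roots.toFinset.filter (fun t => 0 < t)).card ≤ m := by
    rw [hPdef]; exact card_posRoots_prod_le_of_oneChange d h01 h12 a hone
  refine (card_posRoots_le_of_threePoint P _ hP ?_).trans (by omega)
  intro x₁ x₂ x₃ hx₁ h12' h23 hW₁ hW₂ hW₃ hfreeI
  have hfree : ∀ r ∈ P.roots.toFinset.filter (fun t => 0 < t), ¬ (x₁ ≤ r ∧ r ≤ x₃) := by
    intro r hr hrI
    rw [Finset.mem_filter, Multiset.mem_toFinset, mem_roots hP] at hr
    exact hfreeI r ⟨hrI.1, hrI.2⟩ hr.1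
  have hrowfree := row_eval_ne_zero_of_free (fun j => (∑ l, C (a j l) * X ^ (d l) : ℝ[X])) hP hx₁ hfree
  have hsign : ∀ j, 0 < (∑ l, C (a j l) * X ^ (d l) : ℝ[X]).eval x₁ * (∑ l, C (a j l) * X ^ (d l) : ℝ[X]).eval x₃ := fun j =>
    eval_mul_eval_pos_of_no_root _ (h12'.trans h23).le (hrowfree j)
  refine oneBump_company_wronskian_no_three_zeros d e₁ e₂ he₁ he₂ a j₀ (u := x₁) (v := x₃) hx₁ ?_
    (fun j hj => Or.inl ⟨hpole j hj, hsign j⟩) le_rfl h12' h23 le_rfl ?_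
  · rcases hknee with h | h | h
    · exact Or.inl h
    · exact Or.inr (Or.inl h)
    · exact Or.inr (Or.inr (Or.inl h))
  · intro x hx
    simp only [Set.mem_insert_iff, Set.mem_singleton_iff] at hx
    rcases hx with rfl | rfl | rfl
    · exact hW₁
    · exact hW₂
    · exact hW₃

/-- The rows of the one-riser pole class are one-change rows. [folklore] -/
theorem oneRiser_poles_oneChange (j₀ : Fin m) (hriser : 0 < a j₀ 0 ∧ a j₀ 1 < 0 ∧ a j₀ 2 < 0)
    (hpole : ∀ j, j ≠ j₀ → (a j 2 = 0 ∧ a j 0 * a j 1 < 0) ∨ (a j 0 = 0 ∧ a j 1 * a j 2 < 0) ∨ (a j 1 = 0 ∧ a j 0 * a j 2 < 0)) :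
    ∀ j, ¬ (a j 0 * a j 1 < 0 ∧ a j 1 * a j 2 < 0) := by
  intro j
  by_cases hj : j = j₀
  · subst hj
    rintro ⟨-, h⟩
    have : 0 < a j 1 * a j 2 := mul_pos_of_neg_of_neg hriser.2.1 hriser.2.2
    linarith
  · exact poleBinomial_oneChange (hpole j hj)

/-- ★★ **EB2-W ON THE ONE-RISER POLE CLASS** (`K = 3`, every `m`, window-free): ONE incoherent riser row `j₀` of type `(+,−,−)` (strictly) and pole
binomials on any pairs elsewhere ⇒ `Z₊(W(∏_j f_j)) ≤ 3·m + 2`.  On windows left of the riser's root every row is a background row (the riser is an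
unswitched cloud row) and `W(∏ f_j) < 0` there (✓ `background_logWronskian_eval_neg`); on windows right of it the riser is the switched bump of the
one-bump cell (✓ `oneBump_company_wronskian_no_three_zeros`). [this file's theorem] -/
theorem oneRiser_poles_wronskian_card_le (h01 : d 0 < d 1) (h12 : d 1 < d 2) (j₀ : Fin m)
    (hriser : 0 < a j₀ 0 ∧ a j₀ 1 < 0 ∧ a j₀ 2 < 0)
    (hpole : ∀ j, j ≠ j₀ → (a j 2 = 0 ∧ a j 0 * a j 1 < 0) ∨ (a j 0 = 0 ∧ a j 1 * a j 2 < 0) ∨ (a j 1 = 0 ∧ a j 0 * a j 2 < 0)) :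
    (((∏ j, ∑ l, C (a j l) * X ^ (d l) : ℝ[X]) * (X * derivative (X * derivative (∏ j, ∑ l, C (a j l) * X ^ (d l) : ℝ[X])))
        - (X * derivative (∏ j, ∑ l, C (a j l) * X ^ (d l) : ℝ[X])) ^ 2).roots.toFinset.filter (fun t => 0 < t)).card ≤ 3 * m + 2 := by
  classical
  set P : ℝ[X] := ∏ j, ∑ l, C (a j l) * X ^ (d l) with hPdef
  by_cases hP : P = 0
  · rw [wronskian_card_eq_zero_of_prod_eq_zero d a hP]; exact Nat.zero_le _
  obtain ⟨e₁, he₁⟩ := Nat.exists_eq_add_of_lt h01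
  obtain ⟨e₂, he₂⟩ := Nat.exists_eq_add_of_lt h12
  have hm : 0 < m := Fin.pos j₀
  have hone := oneRiser_poles_oneChange a j₀ hriser hpole
  have hZP : (P.roots.toFinset.filter (fun t => 0 < t)).card ≤ m := by
    rw [hPdef]; exact card_posRoots_prod_le_of_oneChange d h01 h12 a hone
  refine (card_posRoots_le_of_threePoint P _ hP ?_).trans (by omega)
  intro x₁ x₂ x₃ hx₁ h12' h23 hW₁ hW₂ hW₃ hfreeI
  have hfree : ∀ r ∈ P.roots.toFinset.filter (fun t => 0 < t), ¬ (x₁ ≤ r ∧ r ≤ x₃) := by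
    intro r hr hrI
    rw [Finset.mem_filter, Multiset.mem_toFinset, mem_roots hP] at hr
    exact hfreeI r ⟨hrI.1, hrI.2⟩ hr.1
  have hrowfree := row_eval_ne_zero_of_free (fun j => (∑ l, C (a j l) * X ^ (d l) : ℝ[X])) hP hx₁ hfree
  have hsign : ∀ j, 0 < (∑ l, C (a j l) * X ^ (d l) : ℝ[X]).eval x₁ * (∑ l, C (a j l) * X ^ (d l) : ℝ[X]).eval x₃ := fun j =>
    eval_mul_eval_pos_of_no_root _ (h12'.trans h23).le (hrowfree j)
  have hf₀ : (∑ l, C (a j₀ l) * X ^ (d l) : ℝ[X]).eval x₁ ≠ 0 := hrowfree j₀ x₁ (left_mem_Icc.2 (h12'.trans h23).le)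
  rcases lt_or_gt_of_ne hf₀ with hneg | hpos
  · -- switched riser: the one-bump cell on `[x₁, x₃]`
    refine oneBump_company_wronskian_no_three_zeros d e₁ e₂ he₁ he₂ a j₀ (u := x₁) (v := x₃) hx₁
      (Or.inr (Or.inr (Or.inr (Or.inl ⟨hriser.1, hriser.2.1, hriser.2.2, hneg⟩)))) (fun j hj => Or.inl ⟨hpole j hj, hsign j⟩)
      le_rfl h12' h23 le_rfl ?_
    intro x hx
    simp only [Set.mem_insert_iff, Set.mem_singleton_iff] at hx
    rcases hx with rfl | rfl | rfl
    · exact hW₁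
    · exact hW₂
    · exact hW₃
  · -- unswitched riser: every row is background on a window around `x₁`, so `W(x₁) < 0`
    have hfree₁ : ∀ r ∈ P.roots.toFinset.filter (fun t => 0 < t), ¬ (x₁ ≤ r ∧ r ≤ x₁) := fun r hr hrI =>
      hfree r hr ⟨hrI.1, hrI.2.trans (h12'.trans h23).le⟩
    obtain ⟨u, v, hu, hux, hxv, hfreeuv⟩ := exists_window_extension _ hx₁ le_rfl hfree₁
    have hrowfree' := row_eval_ne_zero_of_free (fun j => (∑ l, C (a j l) * X ^ (d l) : ℝ[X])) hP hu hfreeuv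
    have hsign' : ∀ j, 0 < (∑ l, C (a j l) * X ^ (d l) : ℝ[X]).eval u * (∑ l, C (a j l) * X ^ (d l) : ℝ[X]).eval v := fun j =>
      eval_mul_eval_pos_of_no_root _ (by linarith) (hrowfree' j)
    have hv₀ : 0 < (∑ l, C (a j₀ l) * X ^ (d l) : ℝ[X]).eval v := by
      have h1 : 0 < (∑ l, C (a j₀ l) * X ^ (d l) : ℝ[X]).eval x₁ * (∑ l, C (a j₀ l) * X ^ (d l) : ℝ[X]).eval v :=
        eval_mul_eval_pos_of_no_root _ hxv.le (fun t ht => hrowfree' j₀ t ⟨hux.le.trans ht.1, ht.2⟩)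
      exact pos_of_mul_pos_right h1 hpos.le
    have hneg := background_logWronskian_eval_neg hm d h01 h12 a hu (fun j => ?_) hux hxv
    · exact absurd hW₁ hneg.ne
    · by_cases hj : j = j₀
      · subst hj
        exact Or.inr (Or.inl ⟨hriser.1, hriser.2.1.le, hriser.2.2.le, by linarith [hriser.2.1, hriser.2.2], hv₀⟩)
      · exact Or.inl ⟨hpole j hj, hsign' j⟩

/-- The rows of the one-coherent pole class are one-change rows. [folklore] -/
theorem oneCoherent_poles_oneChange (j₀ : Fin m) (hcoh : 0 < a j₀ 0 ∧ 0 < a j₀ 1 ∧ a j₀ 2 < 0)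
    (hpole : ∀ j, j ≠ j₀ → (a j 2 = 0 ∧ a j 0 * a j 1 < 0) ∨ (a j 0 = 0 ∧ a j 1 * a j 2 < 0) ∨ (a j 1 = 0 ∧ a j 0 * a j 2 < 0)) :
    ∀ j, ¬ (a j 0 * a j 1 < 0 ∧ a j 1 * a j 2 < 0) := by
  intro j
  by_cases hj : j = j₀
  · subst hj
    rintro ⟨h, -⟩
    have : 0 < a j 0 * a j 1 := mul_pos hcoh.1 hcoh.2.1
    linarith
  · exact poleBinomial_oneChange (hpole j hj)

/-- ★★ **EB2-W ON THE ONE-COHERENT POLE CLASS** (`K = 3`, every `m`, window-free; the `x ↦ 1/x` mirror of the one-riser class): ONE coherent row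
`j₀` of type `(+,+,−)` (strictly) and pole binomials on any pairs elsewhere ⇒ `Z₊(W(∏_j f_j)) ≤ 3·m + 2`.  Left of its root the coherent row is the
unswitched knee-phase bump of the one-bump cell (✓ `oneBump_company_wronskian_no_three_zeros`, `0 < f(v)`); right of it every row is a background row
(✓ `background_logWronskian_eval_neg`, `f(u) < 0`). [this file's theorem] -/
theorem oneCoherent_poles_wronskian_card_le (h01 : d 0 < d 1) (h12 : d 1 < d 2) (j₀ : Fin m)
    (hcoh : 0 < a j₀ 0 ∧ 0 < a j₀ 1 ∧ a j₀ 2 < 0)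
    (hpole : ∀ j, j ≠ j₀ → (a j 2 = 0 ∧ a j 0 * a j 1 < 0) ∨ (a j 0 = 0 ∧ a j 1 * a j 2 < 0) ∨ (a j 1 = 0 ∧ a j 0 * a j 2 < 0)) :
    (((∏ j, ∑ l, C (a j l) * X ^ (d l) : ℝ[X]) * (X * derivative (X * derivative (∏ j, ∑ l, C (a j l) * X ^ (d l) : ℝ[X])))
        - (X * derivative (∏ j, ∑ l, C (a j l) * X ^ (d l) : ℝ[X])) ^ 2).roots.toFinset.filter (fun t => 0 < t)).card ≤ 3 * m + 2 := by
  classical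
  set P : ℝ[X] := ∏ j, ∑ l, C (a j l) * X ^ (d l) with hPdef
  by_cases hP : P = 0
  · rw [wronskian_card_eq_zero_of_prod_eq_zero d a hP]; exact Nat.zero_le _
  obtain ⟨e₁, he₁⟩ := Nat.exists_eq_add_of_lt h01
  obtain ⟨e₂, he₂⟩ := Nat.exists_eq_add_of_lt h12
  have hm : 0 < m := Fin.pos j₀
  have hone := oneCoherent_poles_oneChange a j₀ hcoh hpole
  have hZP : (P.roots.toFinset.filter (fun t => 0 < t)).card ≤ m := by
    rw [hPdef]; exact card_posRoots_prod_le_of_oneChange d h01 h12 a hone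
  refine (card_posRoots_le_of_threePoint P _ hP ?_).trans (by omega)
  intro x₁ x₂ x₃ hx₁ h12' h23 hW₁ hW₂ hW₃ hfreeI
  have hfree : ∀ r ∈ P.roots.toFinset.filter (fun t => 0 < t), ¬ (x₁ ≤ r ∧ r ≤ x₃) := by
    intro r hr hrI
    rw [Finset.mem_filter, Multiset.mem_toFinset, mem_roots hP] at hr
    exact hfreeI r ⟨hrI.1, hrI.2⟩ hr.1
  have hrowfree := row_eval_ne_zero_of_free (fun j => (∑ l, C (a j l) * X ^ (d l) : ℝ[X])) hP hx₁ hfree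
  have hsign : ∀ j, 0 < (∑ l, C (a j l) * X ^ (d l) : ℝ[X]).eval x₁ * (∑ l, C (a j l) * X ^ (d l) : ℝ[X]).eval x₃ := fun j =>
    eval_mul_eval_pos_of_no_root _ (h12'.trans h23).le (hrowfree j)
  have hf₀ : (∑ l, C (a j₀ l) * X ^ (d l) : ℝ[X]).eval x₃ ≠ 0 := hrowfree j₀ x₃ (right_mem_Icc.2 (h12'.trans h23).le)
  rcases lt_or_gt_of_ne hf₀ with hneg | hpos
  · -- past its root on the whole of `[x₁, x₃]`: every row is background on a window around `x₁`, so `W(x₁) < 0`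
    have hx₁neg : (∑ l, C (a j₀ l) * X ^ (d l) : ℝ[X]).eval x₁ < 0 := by
      by_contra hge
      push Not at hge
      have := hsign j₀
      nlinarith
    have hfree₁ : ∀ r ∈ P.roots.toFinset.filter (fun t => 0 < t), ¬ (x₁ ≤ r ∧ r ≤ x₁) := fun r hr hrI =>
      hfree r hr ⟨hrI.1, hrI.2.trans (h12'.trans h23).le⟩
    obtain ⟨u, v, hu, hux, hxv, hfreeuv⟩ := exists_window_extension _ hx₁ le_rfl hfree₁
    have hrowfree' := row_eval_ne_zero_of_free (fun j => (∑ l, C (a j l) * X ^ (d l) : ℝ[X])) hP hu hfreeuv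
    have hsign' : ∀ j, 0 < (∑ l, C (a j l) * X ^ (d l) : ℝ[X]).eval u * (∑ l, C (a j l) * X ^ (d l) : ℝ[X]).eval v := fun j =>
      eval_mul_eval_pos_of_no_root _ (by linarith) (hrowfree' j)
    have hu₀ : (∑ l, C (a j₀ l) * X ^ (d l) : ℝ[X]).eval u < 0 := by
      have h1 : 0 < (∑ l, C (a j₀ l) * X ^ (d l) : ℝ[X]).eval u * (∑ l, C (a j₀ l) * X ^ (d l) : ℝ[X]).eval x₁ :=
        eval_mul_eval_pos_of_no_root _ hux.le (fun t ht => hrowfree' j₀ t ⟨ht.1, ht.2.trans hxv.le⟩)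
      by_contra hge
      push Not at hge
      nlinarith
    have hWneg := background_logWronskian_eval_neg hm d h01 h12 a hu (fun j => ?_) hux hxv
    · exact absurd hW₁ hWneg.ne
    · by_cases hj : j = j₀
      · subst hj
        exact Or.inr (Or.inr ⟨hcoh.1, hcoh.2.1, hcoh.2.2, hu₀⟩)
      · exact Or.inl ⟨hpole j hj, hsign' j⟩
  · -- before its root: the knee-phase bump of the one-bump cell on `[x₁, x₃]`
    refine oneBump_company_wronskian_no_three_zeros d e₁ e₂ he₁ he₂ a j₀ (u := x₁) (v := x₃) hx₁
      (Or.inr (Or.inr (Or.inr (Or.inr ⟨hcoh.1, hcoh.2.1, hcoh.2.2, hpos⟩)))) (fun j hj => Or.inl ⟨hpole j hj, hsign j⟩)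
      le_rfl h12' h23 le_rfl ?_
    intro x hx
    simp only [Set.mem_insert_iff, Set.mem_singleton_iff] at hx
    rcases hx with rfl | rfl | rfl
    · exact hW₁
    · exact hW₂
    · exact hW₃

/-! ### Euler twins: the floor inequality on the three classes, EVERY coupling `l₀` -/

/-- **Floor inequality on the one-knee pole class**: `Z₊(eulerNumerator d a l₀) ≤ 5·m + 3` for every coupling `l₀`. [this file's theorem] -/
theorem oneKnee_poles_eulerNumerator_card_le (h01 : d 0 < d 1) (h12 : d 1 < d 2) (j₀ : Fin m)
    (hknee : (a j₀ 2 = 0 ∧ 0 < a j₀ 0 * a j₀ 1) ∨ (a j₀ 0 = 0 ∧ 0 < a j₀ 1 * a j₀ 2) ∨ (a j₀ 1 = 0 ∧ 0 < a j₀ 0 * a j₀ 2))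
    (hpole : ∀ j, j ≠ j₀ → (a j 2 = 0 ∧ a j 0 * a j 1 < 0) ∨ (a j 0 = 0 ∧ a j 1 * a j 2 < 0) ∨ (a j 1 = 0 ∧ a j 0 * a j 2 < 0))
    (l₀ : Fin 3) :
    ((∑ j, (∑ l, C (a j l * ((d l : ℝ) - d l₀)) * X ^ (d l)) * ∏ i ∈ Finset.univ.erase j, (∑ l, C (a i l) * X ^ (d l))
        : ℝ[X]).roots.toFinset.filter (fun t => 0 < t)).card ≤ 5 * m + 3 := by
  have h1 := card_posRoots_eulerNumerator_le_wronskian_add_of_oneChange d h01 h12 a (oneKnee_poles_oneChange a j₀ hknee hpole) l₀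
  have h2 := oneKnee_poles_wronskian_card_le d a h01 h12 j₀ hknee hpole
  omega

/-- **Floor inequality on the one-riser pole class**: `Z₊(eulerNumerator d a l₀) ≤ 5·m + 3` for every coupling `l₀`. [this file's theorem] -/
theorem oneRiser_poles_eulerNumerator_card_le (h01 : d 0 < d 1) (h12 : d 1 < d 2) (j₀ : Fin m)
    (hriser : 0 < a j₀ 0 ∧ a j₀ 1 < 0 ∧ a j₀ 2 < 0)
    (hpole : ∀ j, j ≠ j₀ → (a j 2 = 0 ∧ a j 0 * a j 1 < 0) ∨ (a j 0 = 0 ∧ a j 1 * a j 2 < 0) ∨ (a j 1 = 0 ∧ a j 0 * a j 2 < 0))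
    (l₀ : Fin 3) :
    ((∑ j, (∑ l, C (a j l * ((d l : ℝ) - d l₀)) * X ^ (d l)) * ∏ i ∈ Finset.univ.erase j, (∑ l, C (a i l) * X ^ (d l))
        : ℝ[X]).roots.toFinset.filter (fun t => 0 < t)).card ≤ 5 * m + 3 := by
  have h1 := card_posRoots_eulerNumerator_le_wronskian_add_of_oneChange d h01 h12 a (oneRiser_poles_oneChange a j₀ hriser hpole) l₀
  have h2 := oneRiser_poles_wronskian_card_le d a h01 h12 j₀ hriser hpole
  omega

/-- **Floor inequality on the one-coherent pole class**: `Z₊(eulerNumerator d a l₀) ≤ 5·m + 3` for every coupling `l₀`. [this file's theorem] -/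
theorem oneCoherent_poles_eulerNumerator_card_le (h01 : d 0 < d 1) (h12 : d 1 < d 2) (j₀ : Fin m)
    (hcoh : 0 < a j₀ 0 ∧ 0 < a j₀ 1 ∧ a j₀ 2 < 0)
    (hpole : ∀ j, j ≠ j₀ → (a j 2 = 0 ∧ a j 0 * a j 1 < 0) ∨ (a j 0 = 0 ∧ a j 1 * a j 2 < 0) ∨ (a j 1 = 0 ∧ a j 0 * a j 2 < 0))
    (l₀ : Fin 3) :
    ((∑ j, (∑ l, C (a j l * ((d l : ℝ) - d l₀)) * X ^ (d l)) * ∏ i ∈ Finset.univ.erase j, (∑ l, C (a i l) * X ^ (d l))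
        : ℝ[X]).roots.toFinset.filter (fun t => 0 < t)).card ≤ 5 * m + 3 := by
  have h1 := card_posRoots_eulerNumerator_le_wronskian_add_of_oneChange d h01 h12 a (oneCoherent_poles_oneChange a j₀ hcoh hpole) l₀
  have h2 := oneCoherent_poles_wronskian_card_le d a h01 h12 j₀ hcoh hpole
  omega

end Classes

end ProductPlusOne

end Summit.ValiantsHypothesis.ValiantsHypothesis.Theorems.LacunarySymmetroidMatrixDescartes
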